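import Summits.ABC.IUTFork.Conditional.AbcOfSGenuineKTameRobustTate
import HarnessLib

/-!
# R-W ANNEX-1 rows DECIDED (refuted side, S_H level) UNCONDITIONALLY by the TATE-EXACT local type `e ∣ 10·l` — the two SMALLEST-INTEGER
# Szpiro-bad admissible data of the programme: `5⁴·11²·13 + 179³ = 2¹⁰·3⁸` at `l = 13` and `2·3·11·13⁴ + 199³ = 5¹⁰` at `l = 11, 17, 19`

PROOF-ONLY file (no `def`, no new `Prop`, no instance) of the abc-iut cell (D-0079 R-W numerics crew seat abc-iut-W-num-4, gen 2 — owner of ANNEX-1 of the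
R-W table of record = the EXHAUSTIVE Szpiro-bad scan N5 over every coprime `a + b = c ≤ 10⁷`, HOME/plan/rescue/R-W/README.md §ANNEX-1, kit j257900/j258386).
TAKES NO SIDE on [IUTchIII] Cor. 3.12 or on any author. Instantiates abc-iut-W-ref-2's `GenuineK.not_pilotKummerCompatHull_chosen_triple_of_ten_top`
(`AbcOfSGenuineKTameRobustTate`, p465202: `3 ∣ v_p(abc)` ⇒ every place `u | p` of `T.K` has `e(u | p) ∣ 10·l` — Serre 1972 n° 1.12, `E[3]` is UNRAMIFIED at a
multiplicative place with `3 ∣ ord Δ_min`, proved in the tree from Kodaira–Néron (p464241/p464995); prime floor `10·l + 2`; abc-iut-w5-d107's robust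
tame-exact decider p459701) at the FOUR (datum, l) pairs of ANNEX-1 that the seat's census N6 (HOME/abc-iut-W-num-4/N6-METHOD.md, two engines, 6,199 rows)
finds decidable under a landed local-type class and that NO OTHER landed decider reaches (`p³ ≤ 10⁷` forces `p ≤ 215 < 15·l + 2`; abc-iut-w5-d107's e-free
`…_of_linUniform` p464182 fires on none of the 6,199 ANNEX-1 rows):
* `5⁴·11²·13 + 179³ = 2¹⁰·3⁸` (`c = 6 718 464`, quality 1.160) at `l = 13`: pole prime `p = 179`, `179³ ∥ abc`, `3 ∣ 3`, `10·13 + 2 = 132 ≤ 179`,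
  top label `j = l⋆ = 6` (`2·13 ≤ (13−3)·3`); N5: Szpiro margin −0.6817, admissible (P2)(P5)(core), (P6) Serre-witnessed, degree locus off, every packet refuted;
* `2·3·11·13⁴ + 199³ = 5¹⁰` (`c = 9 765 625`, quality 1.178) at `l = 11, 17, 19`: pole prime `p = 199`, `199³ ∥ abc`, `3 ∣ 3`, `10·l + 2 = 112 / 172 / 192 ≤ 199`,
  top labels `j = 5 / 8 / 9` (`2l ≤ (l−3)·3`); N5: Szpiro margins −13.19 / −6.53 / −6.86, admissible, (P6) Serre-witnessed, degree locus off, every packet refuted.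
Each theorem: at EVERY genuine Θ-volume datum `T` over `(ratPoint (a/c), l)` the hull-level clause S_H (chosen realising ideles, pinned reading — the per-datum
object of the window binders `hSHw`/`hSHwBad`) FAILS for every choice of the free context binders and Kummer datum. NOT claimed: admissibility /
Szpiro-badness / (P6) of `(ratPoint (a/c), l)` (numerically certified in ANNEX-1, not in the kernel) and non-emptiness of the datum type. HONEST SCOPE as in the
parents: SHARP reading; per-label licence STRONGER than print; «refuted as typed» ≠ «refuted in print»; nothing about the number-level Corollary; typed ≠ proved;
instantiated ≠ endorsed. Inputs per row are integer facts checked by `norm_num`.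
[cite: Mochizuki2012, IUTchIII Cor. 3.12 Step (xi-f) p. 184; IUTchIV Thm. 1.10 proof Steps (ii)–(iii) p. 24–26, Cor. 2.2 (ii) proof p. 44]
[cite: Serre1972, §1.11–§1.12] [cite: MochizukiGenEll2010, Thm. 2.1 p. 11] [claim: Mochizuki2012, status: disputed] for every IUT sentence quoted.
-/

noncomputable section

open Set Function NumberField IsDedekindDomain

namespace Summit.ABC.IUTFork.Conditional

open Thm311 Thm311.Real Cor312 Cor312Vol Cor312Prov Literature.IUT.LogThetaLattice Literature.IUT.LogVolume
  Literature.IUT.HodgeTheaters Literature.IUT.LogVolume.ThetaData Literature.IUT.LogVolume.Cor22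
open Literature.NumberTheory.NumberFields Literature.NumberTheory.GaloisRepresentations.Ultrametric
open Literature.NumberTheory.DiophantineGeometry Literature.NumberTheory.DiophantineGeometry.GenEll Summit.ABC.ABC.Theorems

/-- The abc triple `5⁴·11²·13 + 179³ = 2¹⁰·3⁸` (`983125 + 5735339 = 6718464`, quality 1.160; R-W ANNEX-1 datum `N5:frey-5^4*11^2*13+179^3=2^10*3^8`,
found by the exhaustive scan kit j257900). [folklore] -/
theorem isABCTriple_frey6718464 : IsABCTriple (5 ^ 4 * 11 ^ 2 * 13) (179 ^ 3) (2 ^ 10 * 3 ^ 8) := by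
  refine ⟨by norm_num, by norm_num, by norm_num, ?_⟩
  rw [Nat.coprime_iff_gcd_eq_one]
  norm_num

/-- The abc triple `2·3·11·13⁴ + 199³ = 5¹⁰` (`1885026 + 7880599 = 9765625`, quality 1.178; R-W ANNEX-1 datum `N5:frey-2*3*11*13^4+199^3=5^10`,
found by the exhaustive scan kit j257900). [folklore] -/
theorem isABCTriple_frey9765625 : IsABCTriple (2 * 3 * 11 * 13 ^ 4) (199 ^ 3) (5 ^ 10) := by
  refine ⟨by norm_num, by norm_num, by norm_num, ?_⟩
  rw [Nat.coprime_iff_gcd_eq_one]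
  norm_num

/-- **R-W ANNEX-1 ROW `N5:frey-5^4*11^2*13+179^3=2^10*3^8:13` — REFUTED side, UNCONDITIONALLY** (the smallest-`c` Szpiro-bad admissible (datum, l) of the
programme decided at the S_H level: `c = 6 718 464`; N5 Szpiro margin −0.6817): triple `5⁴·11²·13 + 179³ = 2¹⁰·3⁸`, deciding packet the pole prime
`p = 179` (`179³ ∥ abc`, `3 ∣ 3`, so every place `u | 179` of `T.K` has `e(u | 179) ∣ 10·13 = 130 ≤ 177`; `179 ∉ {2, 3, 5, 13}`; `10·13 + 2 ≤ 179`), top label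
`j = l⋆ = 6` (`2·13 ≤ (13−3)·3`): S_H FAILS at every genuine Θ-volume datum over `(ratPoint (a/c), 13)`, every choice of the free binders.
[cite: Mochizuki2012, IUTchIII Cor. 3.12 Step (xi-f) p. 184] [cite: Serre1972, §1.11–§1.12] [claim: Mochizuki2012, status: disputed] -/
theorem GenuineK.not_pilotKummerCompatHull_chosen_frey6718464_thirteen
    (T : Cor22.ThetaVolumeDatumAt (ratPoint (((5 ^ 4 * 11 ^ 2 * 13 : ℕ) : ℚ) / (2 ^ 10 * 3 ^ 8 : ℕ))) 13) :
    letI := T.instFieldF; letI := T.instNumberFieldF; letI := T.instAlgebraF; letI := T.instFieldK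
    letI := T.instNumberFieldK; letI := T.instAlgebraK; letI := T.instFieldFbar; letI := T.instAlgebraFbar
    letI := T.instAlgebraKFbar; letI := T.instIsElliptic
    ∀ (M : Type) [Field M] [NumberField M]
      (archPk : ∀ (j : (thetaIndex (pilotDataOfK T.D T.K)).Label) (vQ : (thetaIndex (pilotDataOfK T.D T.K)).VQ),
        Set ((logShellsDH (pilotDataOfK T.D T.K) (analyticLogv T.K)).Packet j vQ))
      (archSub : ∀ (j : (thetaIndex (pilotDataOfK T.D T.K)).Label) (v : (thetaIndex (pilotDataOfK T.D T.K)).V),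
        Set ((logShellsDH (pilotDataOfK T.D T.K) (analyticLogv T.K)).Packet j ((thetaIndex (pilotDataOfK T.D T.K)).over v)))
      (Ψ : ℤ → ∀ v : (thetaIndex (pilotDataOfK T.D T.K)).V, v ∈ (thetaIndex (pilotDataOfK T.D T.K)).Vbad →
        Set ((logShellsDH (pilotDataOfK T.D T.K) (analyticLogv T.K)).StarPacket v))
      (act : ℤ → ∀ v : (thetaIndex (pilotDataOfK T.D T.K)).V, v ∈ (thetaIndex (pilotDataOfK T.D T.K)).Vbad →
        (logShellsDH (pilotDataOfK T.D T.K) (analyticLogv T.K)).StarPacket v →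
          Module.End ℚ ((logShellsDH (pilotDataOfK T.D T.K) (analyticLogv T.K)).StarPacket v))
      (Mmod : ℤ → ∀ j : (thetaIndex (pilotDataOfK T.D T.K)).LabelStar, Set ((logShellsDH (pilotDataOfK T.D T.K) (analyticLogv T.K)).GlobalPacket j.1))
      (region : ℤ → ∀ j : (thetaIndex (pilotDataOfK T.D T.K)).LabelStar, FinDivisor M → ∀ vQ : (thetaIndex (pilotDataOfK T.D T.K)).VQ,
        Set ((logShellsDH (pilotDataOfK T.D T.K) (analyticLogv T.K)).Packet j.1 vQ))
      (frobAdm : ℤ → ℤ → ∀ (j : (thetaIndex (pilotDataOfK T.D T.K)).Label) (vQ : (thetaIndex (pilotDataOfK T.D T.K)).VQ),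
        Set ((logShellsDH (pilotDataOfK T.D T.K) (analyticLogv T.K)).Packet j vQ) → Prop)
      (frobLogvol : ℤ → ℤ → ∀ (j : (thetaIndex (pilotDataOfK T.D T.K)).Label) (vQ : (thetaIndex (pilotDataOfK T.D T.K)).VQ),
        Set ((logShellsDH (pilotDataOfK T.D T.K) (analyticLogv T.K)).Packet j vQ) → ℝ)
      (frobΨ : ℤ → ℤ → ∀ v : (thetaIndex (pilotDataOfK T.D T.K)).V, v ∈ (thetaIndex (pilotDataOfK T.D T.K)).Vbad →
        Set ((logShellsDH (pilotDataOfK T.D T.K) (analyticLogv T.K)).StarPacket v))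
      (frobMmod : ℤ → ℤ → ∀ j : (thetaIndex (pilotDataOfK T.D T.K)).LabelStar, Set ((logShellsDH (pilotDataOfK T.D T.K) (analyticLogv T.K)).GlobalPacket j.1))
      (unitImage : ℤ → ℤ → ℕ → ∀ (j : (thetaIndex (pilotDataOfK T.D T.K)).Label) (vQ : (thetaIndex (pilotDataOfK T.D T.K)).VQ),
        Set ((logShellsDH (pilotDataOfK T.D T.K) (analyticLogv T.K)).Packet j vQ))
      (ballImage : ℤ → ℤ → ∀ (j : (thetaIndex (pilotDataOfK T.D T.K)).Label) (vQ : (thetaIndex (pilotDataOfK T.D T.K)).VQ),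
        Set ((logShellsDH (pilotDataOfK T.D T.K) (analyticLogv T.K)).Packet j vQ))
      (thetaDiv : ℤ → ℤ → LgpDivisor M (thetaIndex (pilotDataOfK T.D T.K)).lstar)
      (n : ℤ) {HT : Type} {LogLink : HT → HT → Type} {IsFull : ∀ {s t : HT}, LogLink s t → Prop}
      (lat : LGPGaussianLogThetaLattice LogLink IsFull)
      {Frd : Type} {IsoF : Frd → Frd → Type} {Ob : Frd → Type} {realify : Frd → Frd} {Strip : Type}
      {IsoS : Strip → Strip → Type} {Mv : ∀ v : (thetaIndex (pilotDataOfK T.D T.K)).V, v ∈ (thetaIndex (pilotDataOfK T.D T.K)).Vbad → Type}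
      [∀ v h, Monoid (Mv v h)]
      (sig : GlobalLGPFrobenioidSignature (thetaIndex (pilotDataOfK T.D T.K)).lstar (thetaIndex (pilotDataOfK T.D T.K)).V
        (· ∈ (thetaIndex (pilotDataOfK T.D T.K)).Vbad) Frd IsoF Ob realify Strip IsoS Mv)
      (split : SplittingMonoids Mv) {ObΔ : Type} {N : ∀ v : (thetaIndex (pilotDataOfK T.D T.K)).V, v ∈ (thetaIndex (pilotDataOfK T.D T.K)).Vbad → Type}
      [∀ v h, Monoid (N v h)] (qData : QPilotData ObΔ N)
      (qK : ∀ v : (thetaIndex (pilotDataOfK T.D T.K)).V, v ∈ (thetaIndex (pilotDataOfK T.D T.K)).Vbad →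
        Set ((logShellsDH (pilotDataOfK T.D T.K) (analyticLogv T.K)).StarPacket v)),
      ¬ Cor312Vol.PilotKummerCompatHull
          (LatticeSituation.ofShells (logShellsDH (pilotDataOfK T.D T.K) (analyticLogv T.K)) M archPk archSub
            (summandPiecesPr (pilotDataOfK T.D T.K) (logvAnalytic_analyticLogv (F := T.K))).Adm
            (summandPiecesPr (pilotDataOfK T.D T.K) (logvAnalytic_analyticLogv (F := T.K))).logvol Ψ act Mmod region frobAdm frobLogvol frobΨ
            frobMmod unitImage ballImage thetaDiv)
          (settingPrVolSharp (pilotDataOfK T.D T.K) (logvAnalytic_analyticLogv (F := T.K)) M archPk archSub Ψ act Mmod region n lat sig split qData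
            (exists_realising_qIdeles_pilotDataOfK T.D).choose (exists_realising_thetaIdeles_pilotDataOfK T.D).choose
            (exists_realising_qIdeles_pilotDataOfK T.D).choose_spec.1 (exists_realising_qIdeles_pilotDataOfK T.D).choose_spec.2.1)
          (fun _ => Cor312.Setting.qRegion
            (settingPrVolSharp (pilotDataOfK T.D T.K) (logvAnalytic_analyticLogv (F := T.K)) M archPk archSub Ψ act Mmod region n lat sig split qData
              (exists_realising_qIdeles_pilotDataOfK T.D).choose (exists_realising_thetaIdeles_pilotDataOfK T.D).choose
              (exists_realising_qIdeles_pilotDataOfK T.D).choose_spec.1 (exists_realising_qIdeles_pilotDataOfK T.D).choose_spec.2.1)) qK :=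
  GenuineK.not_pilotKummerCompatHull_chosen_triple_of_ten_top isABCTriple_frey6718464 T ⟨179, by norm_num⟩ (by norm_num) (by norm_num)
    (by norm_num) (by norm_num) (by norm_num) 3 (by norm_num) (dvd_mul_of_dvd_left (dvd_mul_of_dvd_right (by norm_num) _) _) (by norm_num)
    (by norm_num) (by norm_num)

/-- **R-W ANNEX-1 ROWS `N5:frey-2*3*11*13^4+199^3=5^10` at `:11`, `:17`, `:19` — REFUTED side, UNCONDITIONALLY** (`c = 9 765 625 = 5¹⁰`; N5 Szpiro margins
−13.19 / −6.53 / −6.86): triple `2·3·11·13⁴ + 199³ = 5¹⁰`, deciding packet the pole prime `p = 199` (`199³ ∥ abc`, `3 ∣ 3`, so every place `u | 199` of `T.K`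
has `e(u | 199) ∣ 10·l ≤ 190 ≤ 197`; `199 ∉ {2, 3, 5, l}`; `10·l + 2 ≤ 192 ≤ 199`), top label `j = l⋆ = 5 / 8 / 9` (`2l ≤ (l−3)·3` for `l = 11, 17, 19`):
S_H FAILS at every genuine Θ-volume datum over `(ratPoint (a/c), l)` for each listed `l`, every choice of the free binders (one kernel statement per `l`;
`l = 13` is Szpiro-GOOD here and not listed). [cite: Mochizuki2012, IUTchIII Cor. 3.12 Step (xi-f) p. 184] [cite: Serre1972, §1.11–§1.12]
[claim: Mochizuki2012, status: disputed] -/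
theorem GenuineK.not_pilotKummerCompatHull_chosen_frey9765625 {l : ℕ} (hl : l = 11 ∨ l = 17 ∨ l = 19)
    (T : Cor22.ThetaVolumeDatumAt (ratPoint (((2 * 3 * 11 * 13 ^ 4 : ℕ) : ℚ) / (5 ^ 10 : ℕ))) l) :
    letI := T.instFieldF; letI := T.instNumberFieldF; letI := T.instAlgebraF; letI := T.instFieldK
    letI := T.instNumberFieldK; letI := T.instAlgebraK; letI := T.instFieldFbar; letI := T.instAlgebraFbar
    letI := T.instAlgebraKFbar; letI := T.instIsElliptic
    ∀ (M : Type) [Field M] [NumberField M]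
      (archPk : ∀ (j : (thetaIndex (pilotDataOfK T.D T.K)).Label) (vQ : (thetaIndex (pilotDataOfK T.D T.K)).VQ),
        Set ((logShellsDH (pilotDataOfK T.D T.K) (analyticLogv T.K)).Packet j vQ))
      (archSub : ∀ (j : (thetaIndex (pilotDataOfK T.D T.K)).Label) (v : (thetaIndex (pilotDataOfK T.D T.K)).V),
        Set ((logShellsDH (pilotDataOfK T.D T.K) (analyticLogv T.K)).Packet j ((thetaIndex (pilotDataOfK T.D T.K)).over v)))
      (Ψ : ℤ → ∀ v : (thetaIndex (pilotDataOfK T.D T.K)).V, v ∈ (thetaIndex (pilotDataOfK T.D T.K)).Vbad →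
        Set ((logShellsDH (pilotDataOfK T.D T.K) (analyticLogv T.K)).StarPacket v))
      (act : ℤ → ∀ v : (thetaIndex (pilotDataOfK T.D T.K)).V, v ∈ (thetaIndex (pilotDataOfK T.D T.K)).Vbad →
        (logShellsDH (pilotDataOfK T.D T.K) (analyticLogv T.K)).StarPacket v →
          Module.End ℚ ((logShellsDH (pilotDataOfK T.D T.K) (analyticLogv T.K)).StarPacket v))
      (Mmod : ℤ → ∀ j : (thetaIndex (pilotDataOfK T.D T.K)).LabelStar, Set ((logShellsDH (pilotDataOfK T.D T.K) (analyticLogv T.K)).GlobalPacket j.1))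
      (region : ℤ → ∀ j : (thetaIndex (pilotDataOfK T.D T.K)).LabelStar, FinDivisor M → ∀ vQ : (thetaIndex (pilotDataOfK T.D T.K)).VQ,
        Set ((logShellsDH (pilotDataOfK T.D T.K) (analyticLogv T.K)).Packet j.1 vQ))
      (frobAdm : ℤ → ℤ → ∀ (j : (thetaIndex (pilotDataOfK T.D T.K)).Label) (vQ : (thetaIndex (pilotDataOfK T.D T.K)).VQ),
        Set ((logShellsDH (pilotDataOfK T.D T.K) (analyticLogv T.K)).Packet j vQ) → Prop)
      (frobLogvol : ℤ → ℤ → ∀ (j : (thetaIndex (pilotDataOfK T.D T.K)).Label) (vQ : (thetaIndex (pilotDataOfK T.D T.K)).VQ),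
        Set ((logShellsDH (pilotDataOfK T.D T.K) (analyticLogv T.K)).Packet j vQ) → ℝ)
      (frobΨ : ℤ → ℤ → ∀ v : (thetaIndex (pilotDataOfK T.D T.K)).V, v ∈ (thetaIndex (pilotDataOfK T.D T.K)).Vbad →
        Set ((logShellsDH (pilotDataOfK T.D T.K) (analyticLogv T.K)).StarPacket v))
      (frobMmod : ℤ → ℤ → ∀ j : (thetaIndex (pilotDataOfK T.D T.K)).LabelStar, Set ((logShellsDH (pilotDataOfK T.D T.K) (analyticLogv T.K)).GlobalPacket j.1))
      (unitImage : ℤ → ℤ → ℕ → ∀ (j : (thetaIndex (pilotDataOfK T.D T.K)).Label) (vQ : (thetaIndex (pilotDataOfK T.D T.K)).VQ),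
        Set ((logShellsDH (pilotDataOfK T.D T.K) (analyticLogv T.K)).Packet j vQ))
      (ballImage : ℤ → ℤ → ∀ (j : (thetaIndex (pilotDataOfK T.D T.K)).Label) (vQ : (thetaIndex (pilotDataOfK T.D T.K)).VQ),
        Set ((logShellsDH (pilotDataOfK T.D T.K) (analyticLogv T.K)).Packet j vQ))
      (thetaDiv : ℤ → ℤ → LgpDivisor M (thetaIndex (pilotDataOfK T.D T.K)).lstar)
      (n : ℤ) {HT : Type} {LogLink : HT → HT → Type} {IsFull : ∀ {s t : HT}, LogLink s t → Prop}
      (lat : LGPGaussianLogThetaLattice LogLink IsFull)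
      {Frd : Type} {IsoF : Frd → Frd → Type} {Ob : Frd → Type} {realify : Frd → Frd} {Strip : Type}
      {IsoS : Strip → Strip → Type} {Mv : ∀ v : (thetaIndex (pilotDataOfK T.D T.K)).V, v ∈ (thetaIndex (pilotDataOfK T.D T.K)).Vbad → Type}
      [∀ v h, Monoid (Mv v h)]
      (sig : GlobalLGPFrobenioidSignature (thetaIndex (pilotDataOfK T.D T.K)).lstar (thetaIndex (pilotDataOfK T.D T.K)).V
        (· ∈ (thetaIndex (pilotDataOfK T.D T.K)).Vbad) Frd IsoF Ob realify Strip IsoS Mv)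
      (split : SplittingMonoids Mv) {ObΔ : Type} {N : ∀ v : (thetaIndex (pilotDataOfK T.D T.K)).V, v ∈ (thetaIndex (pilotDataOfK T.D T.K)).Vbad → Type}
      [∀ v h, Monoid (N v h)] (qData : QPilotData ObΔ N)
      (qK : ∀ v : (thetaIndex (pilotDataOfK T.D T.K)).V, v ∈ (thetaIndex (pilotDataOfK T.D T.K)).Vbad →
        Set ((logShellsDH (pilotDataOfK T.D T.K) (analyticLogv T.K)).StarPacket v)),
      ¬ Cor312Vol.PilotKummerCompatHull
          (LatticeSituation.ofShells (logShellsDH (pilotDataOfK T.D T.K) (analyticLogv T.K)) M archPk archSub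
            (summandPiecesPr (pilotDataOfK T.D T.K) (logvAnalytic_analyticLogv (F := T.K))).Adm
            (summandPiecesPr (pilotDataOfK T.D T.K) (logvAnalytic_analyticLogv (F := T.K))).logvol Ψ act Mmod region frobAdm frobLogvol frobΨ
            frobMmod unitImage ballImage thetaDiv)
          (settingPrVolSharp (pilotDataOfK T.D T.K) (logvAnalytic_analyticLogv (F := T.K)) M archPk archSub Ψ act Mmod region n lat sig split qData
            (exists_realising_qIdeles_pilotDataOfK T.D).choose (exists_realising_thetaIdeles_pilotDataOfK T.D).choose
            (exists_realising_qIdeles_pilotDataOfK T.D).choose_spec.1 (exists_realising_qIdeles_pilotDataOfK T.D).choose_spec.2.1)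
          (fun _ => Cor312.Setting.qRegion
            (settingPrVolSharp (pilotDataOfK T.D T.K) (logvAnalytic_analyticLogv (F := T.K)) M archPk archSub Ψ act Mmod region n lat sig split qData
              (exists_realising_qIdeles_pilotDataOfK T.D).choose (exists_realising_thetaIdeles_pilotDataOfK T.D).choose
              (exists_realising_qIdeles_pilotDataOfK T.D).choose_spec.1 (exists_realising_qIdeles_pilotDataOfK T.D).choose_spec.2.1)) qK := by
  rcases hl with rfl | rfl | rfl
  · exact GenuineK.not_pilotKummerCompatHull_chosen_triple_of_ten_top isABCTriple_frey9765625 T ⟨199, by norm_num⟩ (by norm_num)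
      (by norm_num) (by norm_num) (by norm_num) (by norm_num) 3 (by norm_num) (dvd_mul_of_dvd_left (dvd_mul_of_dvd_right (by norm_num) _) _)
      (by norm_num) (by norm_num) (by norm_num)
  · exact GenuineK.not_pilotKummerCompatHull_chosen_triple_of_ten_top isABCTriple_frey9765625 T ⟨199, by norm_num⟩ (by norm_num)
      (by norm_num) (by norm_num) (by norm_num) (by norm_num) 3 (by norm_num) (dvd_mul_of_dvd_left (dvd_mul_of_dvd_right (by norm_num) _) _)
      (by norm_num) (by norm_num) (by norm_num)
  · exact GenuineK.not_pilotKummerCompatHull_chosen_triple_of_ten_top isABCTriple_frey9765625 T ⟨199, by norm_num⟩ (by norm_num)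
      (by norm_num) (by norm_num) (by norm_num) (by norm_num) 3 (by norm_num) (dvd_mul_of_dvd_left (dvd_mul_of_dvd_right (by norm_num) _) _)
      (by norm_num) (by norm_num) (by norm_num)

end Summit.ABC.IUTFork.Conditional

end
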